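import Literature.NumberTheory.EllipticCurves.IwasawaAlgebraInvolutionFixedPrimesProofs
import Literature.NumberTheory.EllipticCurves.IwasawaAlgebraInvolutionInvariantsProofs
import Literature.NumberTheory.EllipticCurves.IwasawaAlgebraGenericSpecializationRankProofs
import Mathlib.RingTheory.Flat.Localization
import HarnessLib

/-!
# At a prime of `Λ = ℤ_p⟦T⟧` FIXED by the Iwasawa involution `ι : T ↦ (1+T)⁻¹ − 1` and not containing `T`,
# the `λ`-invariant `rank_{ℤ_p} Λ/𝔭` is EVEN (`p` odd) — proofs only (0 def, 0 fact, 0 instance)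

Topic `NumberTheory/EllipticCurves` (sequel of `IwasawaAlgebraInvolutionFixedPrimesProofs.lean`, which shows that
`(T)` and `(p)` ARE `ι`-fixed; namespace `Literature.NumberTheory.EllipticCurves.IwasawaAlgebra`). THEOREMS ONLY.

## What is proved
* §1 (generic, Mathlib only) `even_finrank_tensorProduct_of_involutive` — for a commutative `R`-algebra `O`, an
  `R`-algebra involution `σ` of `O` (`σ ∘ σ = id`) and an element `a` with `σ a = −a` which is regular on `O`, the
  `K`-dimension of `K ⊗_R O` is EVEN for every field `K` flat over `R` with `2 ≠ 0` (if infinite, `finrank = 0`):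
  multiplication by `1 ⊗ a` exchanges the `±1`-eigenspaces of `1 ⊗ σ` injectively.
* §2 `lambdaInvariant_eq_finrank_tensorProduct` — plumbing: the tree's `lambdaInvariant p M`
  (`dim_{ℚ_p} ℚ_p ⊗_{ℤ_p} M` on the `RestrictScalars` synonym) is `dim_{ℚ_p} ℚ_p ⊗_{ℤ_p} M` for any compatible
  `ℤ_p`-structure (`IsScalarTower ℤ_p Λ M`).
* §3 `X_sub_invol_X_notMem` — `T − ιT ∉ 𝔭` for a prime `𝔭 ∌ T` of `Λ`, `p ≠ 2`
  (`(1+T)(T − ιT) = T(T+2)` and `T + 2 ∈ Λˣ`); **`even_lambdaInvariant_quotient_of_comap_invol_eq`** — for `p ≠ 2`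
  and a prime `𝔭` of `Λ` with `ι𝔭 = 𝔭` and `T ∉ 𝔭`, `λ(Λ/𝔭) = rank_{ℤ_p}(Λ/𝔭)` is even (no height or `p ∉ 𝔭`
  hypothesis: where `Λ/𝔭` is not `ℤ_p`-finite-free the invariant is `0`).
* §3b `even_lambdaInvariant_quotient_of_comap_invol_eq_of_X_add_C_two_notMem` — the same for EVERY `p` (incl.
  `p = 2`) under the extra exclusion `T + 2 ∉ 𝔭` (at `p = 2`, `(T)` and `(T + 2)` are the two `ι`-fixed height-one
  primes of `λ = 1`); `X_sub_invol_X_notMem_of_X_add_C_two_notMem`, `comap_invol_ne_of_odd_lambdaInvariant_of_X_add_C_two_notMem`.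
* §4 consequences — `comap_invol_ne_of_odd_lambdaInvariant` (a prime `𝔭 ∌ T` with ODD `λ(Λ/𝔭)` is moved by `ι`),
  `lambdaInvariant_quotient_span_X_sub_C` (`λ(Λ/(T − c)) = 1`, `c ∈ 𝔪_{ℤ_p}`), `X_notMem_span_X_sub_C` and
  **`comap_invol_ne_of_asIdeal_eq_span_X_sub_C`**: a linear prime `(T − c)`, `c ∈ 𝔪_{ℤ_p} ∖ {0}`, is NEVER
  `ι`-fixed for `p` odd — a simple `ℤ_p`-rational zero `u ≠ 0` of a `p`-adic `L`-function and its mirror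
  `ιu = (1+u)⁻¹ − 1` are two distinct points.
* §4b `invol_X_sub_C_eq_mul`, `comap_invol_span_X_sub_C` — the mirror EXPLICITLY: `ι⁻¹(T − c) = (T − c')` whenever
  `(1 + c)(1 + c') = 1` (`γ ↦ γ⁻¹` on `1 + 𝔪_{ℤ_p}`).
* §4c `lambdaInvariant_quotient_comap_invol_eq` — `λ(Λ/ι⁻¹𝔭) = λ(Λ/𝔭)`: the degree `λ(Λ/𝔭)` is an `ι`-symmetric
  weight on `Spec Λ` (via the tree's `lambdaInvariant_eq_of_involSemilinear`).
The parity bookkeeping these feed (`∑_𝔭 λ(Λ/𝔭)·e(𝔭)` is even for `ι`-symmetric `e` on an `ι`-stable finite set of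
primes `∌ T`) is assembled problem-side (`Summits/…/Theorems/…IotaFixedParityDoor.lean`).

WHY (use; nothing arithmetic is asserted here). In the `ι`-ledger of the signed / ♯♭ main conjectures at a
supersingular prime (BSD cell `bsd-ssimc`, crux `SprungLowerDivisibilityAtThree`, stub `K_spor`; idea card
`stub-katofinelowersporadic-k2-g4` §B «parity / budget-one door», helper B0) the height-one primes off `(p)`, `(T)`
carrying a defect are indexed with the involution `ι`; the contribution of an `ι`-orbit `{𝔭, ι𝔭}` with `𝔭 ≠ ι𝔭` to a
`λ`-count is doubled, and §3 says the `ι`-FIXED primes contribute even degrees too, so `ι`-symmetric `λ`-budgets are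
congruent mod `2` to their `(T)`-term. BSD / the crux are NOT proved by any of this; pure commutative algebra.

References: L. Washington, GTM 83, §7.1, §13.2 (`Λ`, distinguished polynomials, `Λ/(f) ≅ ℤ_p^{deg f}`)
[Washington1997]; B. Mazur, J. Tate, J. Teitelbaum, Invent. Math. 84 (1986) Ch. I §17 (the involution and the
functional equation) [MazurTateTeitelbaum1986Invent]; R. Greenberg, LNM 1716 §1 p. 60, §4 p. 117 [GreenbergLNM1716].
-/

set_option autoImplicit false

noncomputable section

open scoped TensorProduct

namespace Literature.NumberTheory.EllipticCurves.IwasawaAlgebra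

open Literature.NumberTheory.EllipticCurves

/-! ## §1 Generic: an algebra involution with a regular anti-invariant element forces even rank after base change -/

section Generic

variable {R : Type*} [CommRing R] {K : Type*} [Field K] [Algebra R K]
  {O : Type*} [CommRing O] [Algebra R O]

/-- **Even dimension from an involution with a regular anti-invariant element.** Let `σ` be an `R`-algebra
endomorphism of a commutative `R`-algebra `O` with `σ ∘ σ = id`, and `a ∈ O` with `σ a = −a` such that `x ↦ a·x`
is injective. Then for every field `K` which is a flat `R`-algebra with `(2 : K) ≠ 0`, `dim_K (K ⊗_R O)` is even
(`Module.finrank`, so `0` if infinite-dimensional): `K ⊗ O = W⁺ ⊕ W⁻` (eigenspaces of `1 ⊗ σ`) and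
multiplication by `1 ⊗ a` maps `W⁺ ↪ W⁻`, `W⁻ ↪ W⁺` (injective by flatness). Private proof device (generic linear
algebra, no single source). [folklore] -/
private theorem even_finrank_tensorProduct_of_involutive [Module.Flat R K] (σ : O →ₐ[R] O)
    (hσ : ∀ x, σ (σ x) = x) (a : O) (ha : σ a = -a) (hreg : Function.Injective fun x ↦ a * x)
    (h2 : (2 : K) ≠ 0) : Even (Module.finrank K (K ⊗[R] O)) := by
  classical
  by_cases hfin : Module.Finite K (K ⊗[R] O)
  swap
  · rw [Module.finrank_of_not_finite hfin]
    exact Even.zero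
  -- `τ = 1 ⊗ σ`, `L = 1 ⊗ (a·)`
  let τ : K ⊗[R] O →ₗ[K] K ⊗[R] O := σ.toLinearMap.baseChange K
  let L : K ⊗[R] O →ₗ[K] K ⊗[R] O := (LinearMap.mulLeft R a).baseChange K
  have hτ : ∀ w, τ (τ w) = w := by
    intro w
    induction w using TensorProduct.induction_on with
    | zero => simp only [map_zero]
    | tmul k x => simp only [τ, LinearMap.baseChange_tmul, AlgHom.toLinearMap_apply, hσ]
    | add w₁ w₂ h₁ h₂ => simp only [map_add, h₁, h₂]
  have hτL : ∀ w, τ (L w) = -L (τ w) := by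
    intro w
    induction w using TensorProduct.induction_on with
    | zero => simp only [map_zero, neg_zero]
    | tmul k x =>
        simp only [τ, L, LinearMap.baseChange_tmul, AlgHom.toLinearMap_apply, LinearMap.mulLeft_apply,
          map_mul, ha, neg_mul, TensorProduct.tmul_neg]
    | add w₁ w₂ h₁ h₂ => simp only [map_add, h₁, h₂, neg_add]
  have hL : Function.Injective L := by
    have h := Module.Flat.lTensor_preserves_injective_linearMap (M := K) (LinearMap.mulLeft R a) hreg
    rwa [← LinearMap.baseChange_eq_ltensor] at h
  -- the `±1`-eigenspaces of `τ`
  let Wp : Submodule K (K ⊗[R] O) := LinearMap.ker (τ - LinearMap.id)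
  let Wm : Submodule K (K ⊗[R] O) := LinearMap.ker (τ + LinearMap.id)
  have memWp : ∀ w, w ∈ Wp ↔ τ w = w := fun w ↦ by
    simp only [Wp, LinearMap.mem_ker, LinearMap.sub_apply, LinearMap.id_apply, sub_eq_zero]
  have memWm : ∀ w, w ∈ Wm ↔ τ w = -w := fun w ↦ by
    simp only [Wm, LinearMap.mem_ker, LinearMap.add_apply, LinearMap.id_apply]
    exact add_eq_zero_iff_eq_neg
  have hcompl : IsCompl Wp Wm := by
    refine IsCompl.of_eq ?_ ?_
    · rw [Submodule.eq_bot_iff]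
      intro w hw
      obtain ⟨hwp, hwm⟩ := Submodule.mem_inf.mp hw
      rw [memWp] at hwp
      rw [memWm] at hwm
      have h2w : (2 : K) • w = 0 := by
        rw [two_smul]
        nth_rw 1 [← hwp]
        rw [hwm, neg_add_cancel]
      exact (smul_eq_zero.mp h2w).resolve_left h2
    · rw [Submodule.eq_top_iff']
      intro w
      have hw : w = (2⁻¹ : K) • (w + τ w) + (2⁻¹ : K) • (w - τ w) := by
        rw [← smul_add, add_add_sub_cancel, ← two_smul K w, smul_smul, inv_mul_cancel₀ h2, one_smul]
      rw [hw]
      refine Submodule.add_mem_sup (Submodule.smul_mem _ _ ?_) (Submodule.smul_mem _ _ ?_)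
      · rw [memWp, map_add, hτ, add_comm]
      · rw [memWm, map_sub, hτ, neg_sub]
  -- `L` exchanges the eigenspaces, injectively
  have hLpm : ∀ w ∈ Wp, L w ∈ Wm := fun w hw ↦ by
    rw [memWm, hτL, (memWp w).mp hw]
  have hLmp : ∀ w ∈ Wm, L w ∈ Wp := fun w hw ↦ by
    rw [memWp, hτL, (memWm w).mp hw, map_neg, neg_neg]
  haveI : Module.Finite K (K ⊗[R] O) := hfin
  let Lpm : Wp →ₗ[K] Wm := (L.domRestrict Wp).codRestrict Wm fun w ↦ hLpm w w.2
  let Lmp : Wm →ₗ[K] Wp := (L.domRestrict Wm).codRestrict Wp fun w ↦ hLmp w w.2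
  have hLpm_inj : Function.Injective Lpm := fun x y hxy ↦
    Subtype.ext (hL (by simpa [Lpm] using congrArg Subtype.val hxy))
  have hLmp_inj : Function.Injective Lmp := fun x y hxy ↦
    Subtype.ext (hL (by simpa [Lmp] using congrArg Subtype.val hxy))
  have h1 : Module.finrank K Wp ≤ Module.finrank K Wm := LinearMap.finrank_le_finrank_of_injective hLpm_inj
  have h2' : Module.finrank K Wm ≤ Module.finrank K Wp := LinearMap.finrank_le_finrank_of_injective hLmp_inj
  have hsum : Module.finrank K (K ⊗[R] O) = Module.finrank K Wp + Module.finrank K Wm := by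
    rw [← (Submodule.prodEquivOfIsCompl Wp Wm hcompl).finrank_eq, Module.finrank_prod]
  rw [hsum, le_antisymm h1 h2', ← two_mul]
  exact even_two_mul _

/-- The same with `O` a domain and `a ≠ 0` (regularity is automatic). Private proof device. [folklore] -/
private theorem even_finrank_tensorProduct_of_involutive_of_ne_zero [Module.Flat R K] [IsDomain O] (σ : O →ₐ[R] O)
    (hσ : ∀ x, σ (σ x) = x) (a : O) (ha : σ a = -a) (ha0 : a ≠ 0) (h2 : (2 : K) ≠ 0) :
    Even (Module.finrank K (K ⊗[R] O)) :=
  even_finrank_tensorProduct_of_involutive σ hσ a ha (mul_right_injective₀ ha0) h2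

end Generic

/-! ## §2 Plumbing: `lambdaInvariant` for a module with a compatible `ℤ_p`-structure -/

variable {p : ℕ} [Fact p.Prime]

/-- `λ(M) = dim_{ℚ_p}(ℚ_p ⊗_{ℤ_p} M)` computed with ANY `ℤ_p`-module structure on `M` compatible with the
`Λ`-structure (`IsScalarTower ℤ_p Λ M`), instead of the `RestrictScalars` synonym used in the definition of
`lambdaInvariant` (Washington's `λ = rank_{ℤ_p}`; definitional plumbing — the same statement is proved problem-side as
`Summit.….Theorems.SignedTransportAtTwo.lambdaInvariant_eq_finrank`, restated here so that Literature files can use it).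
[cite: Washington1997, §13.2 (after Thm 13.12)] -/
theorem lambdaInvariant_eq_finrank_tensorProduct (M : Type*) [AddCommGroup M] [Module (IwasawaAlgebra p) M]
    [Module ℤ_[p] M] [IsScalarTower ℤ_[p] (IwasawaAlgebra p) M] :
    lambdaInvariant p M = Module.finrank ℚ_[p] (ℚ_[p] ⊗[ℤ_[p]] M) := by
  let e : RestrictScalars ℤ_[p] (IwasawaAlgebra p) M ≃ₗ[ℤ_[p]] M :=
    { RestrictScalars.addEquiv ℤ_[p] (IwasawaAlgebra p) M with
      map_smul' := fun a x ↦ by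
        change (algebraMap ℤ_[p] (IwasawaAlgebra p) a) • (show M from x) = a • (show M from x)
        exact algebraMap_smul (IwasawaAlgebra p) a (show M from x) }
  unfold lambdaInvariant
  exact (e.baseChange ℤ_[p] ℚ_[p] _ _).finrank_eq

/-- `ℚ_p` is a flat `ℤ_p`-module (a localisation). Private plumbing. [folklore] -/
private theorem flat_padic : Module.Flat ℤ_[p] ℚ_[p] :=
  IsLocalization.flat ℚ_[p] (nonZeroDivisors ℤ_[p])

/-! ## §3 `ι`-fixed primes not containing `T` have even `λ` (`p` odd) -/

variable (p) in
/-- `(1 + T)·(T − ιT) = T·(T + 2)` in `Λ` (from `ιT·(1+T) = −T`). [cite: Washington1997, §7.1 and §13.2] -/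
theorem one_add_X_mul_X_sub_invol_X :
    (1 + PowerSeries.X) * (PowerSeries.X - invol p PowerSeries.X) =
      PowerSeries.X * (PowerSeries.X + PowerSeries.C (2 : ℤ_[p])) := by
  rw [mul_sub, mul_comm (1 + PowerSeries.X) (invol p PowerSeries.X), invol_X_mul_one_add_X, map_ofNat]
  ring

/-- `T + 2` is a unit of `Λ = ℤ_p⟦T⟧` for `p ≠ 2`: its constant term `2` is a `p`-adic unit, and `Λˣ` consists of
the series with unit constant term. [cite: Washington1997, §7.1 (units of `Λ`)] -/
theorem isUnit_X_add_C_two (hp2 : p ≠ 2) :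
    IsUnit (PowerSeries.X + PowerSeries.C (2 : ℤ_[p]) : IwasawaAlgebra p) := by
  rw [PowerSeries.isUnit_iff_constantCoeff, map_add, PowerSeries.constantCoeff_X, PowerSeries.constantCoeff_C,
    zero_add]
  have h : IsUnit ((2 : ℕ) : ℤ_[p]) := by
    rw [PadicInt.isUnit_iff, PadicInt.norm_natCast_eq_one_iff]  -- `‖2‖ = 1 ↔ p.Coprime 2`
    exact (Nat.coprime_primes Fact.out Nat.prime_two).mpr hp2
  exact_mod_cast h

/-- **`T − ιT ∉ 𝔭`** for every prime ideal `𝔭 ∌ T` of `Λ`, `p ≠ 2`: otherwise `T(T+2) = (1+T)(T − ιT) ∈ 𝔭` with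
`T ∉ 𝔭` and `T + 2` a unit. (For `p = 2` this fails at `𝔭 = (T + 2)`, which IS `ι`-fixed.)
[cite: MazurTateTeitelbaum1986Invent, Ch. I §17] -/
theorem X_sub_invol_X_notMem (hp2 : p ≠ 2) {I : Ideal (IwasawaAlgebra p)} (hI : I.IsPrime)
    (hX : (PowerSeries.X : IwasawaAlgebra p) ∉ I) :
    PowerSeries.X - invol p PowerSeries.X ∉ I := by
  intro h
  have hmem : PowerSeries.X * (PowerSeries.X + PowerSeries.C (2 : ℤ_[p])) ∈ I := by
    rw [← one_add_X_mul_X_sub_invol_X p]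
    exact I.mul_mem_left _ h
  rcases hI.mem_or_mem hmem with h1 | h2
  · exact hX h1
  · exact hI.ne_top (I.eq_top_of_isUnit_mem h2 (isUnit_X_add_C_two hp2))

/-- If `ι𝔭 = 𝔭` (as a point of `Spec Λ`) then `ι` maps `𝔭` into itself: `𝔭 ≤ ι⁻¹𝔭` as needed to descend `ι` to
`Λ/𝔭`. Private plumbing. [folklore] -/
private theorem le_comap_invol_of_comap_invol_eq (𝔭 : PrimeSpectrum (IwasawaAlgebra p))
    (hι : PrimeSpectrum.comap (invol p).toRingHom 𝔭 = 𝔭) :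
    𝔭.asIdeal ≤ 𝔭.asIdeal.comap (invol p) := by
  intro f hf
  have h := congrArg PrimeSpectrum.asIdeal hι
  rw [PrimeSpectrum.comap_asIdeal] at h
  rw [Ideal.mem_comap, ← h, Ideal.mem_comap]
  change invol p (invol p f) ∈ 𝔭.asIdeal
  rwa [invol_invol]

/-- **Even `λ` at `ι`-fixed primes.** Let `p ≠ 2` and let `𝔭` be a prime of `Λ = ℤ_p⟦T⟧` fixed by the Iwasawa
involution (`ι𝔭 = 𝔭`) with `T ∉ 𝔭`. Then `λ(Λ/𝔭) = dim_{ℚ_p}(ℚ_p ⊗_{ℤ_p} Λ/𝔭)` is EVEN. Proof: `ι` descends to an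
involution `σ` of the domain `Λ/𝔭`, the class `a` of `T − ιT` is non-zero (`X_sub_invol_X_notMem`) with `σ a = −a`,
and §1 applies with `K = ℚ_p` (flat over `ℤ_p`, `2 ≠ 0`). For a height-one `𝔭 = (f) ∌ p` this says: an irreducible
distinguished `f ≠ T` whose zero set is stable under `u ↦ (1+u)⁻¹ − 1` has even degree (the involution of the open unit
disc has no fixed point but `0` for `p` odd). The excluded cases are genuine: `λ(Λ/(T)) = 1`; for `p = 2`, `(T + 2)` is
`ι`-fixed with `λ = 1`. [cite: MazurTateTeitelbaum1986Invent, Ch. I §17] -/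
theorem even_lambdaInvariant_quotient_of_comap_invol_eq (hp2 : p ≠ 2) (𝔭 : PrimeSpectrum (IwasawaAlgebra p))
    (hι : PrimeSpectrum.comap (invol p).toRingHom 𝔭 = 𝔭)
    (hX : (PowerSeries.X : IwasawaAlgebra p) ∉ 𝔭.asIdeal) :
    Even (lambdaInvariant p (IwasawaAlgebra p ⧸ 𝔭.asIdeal)) := by
  -- `ι` descends to `σ : Λ/𝔭 →ₐ[ℤ_p] Λ/𝔭`, an involution
  let σ : (IwasawaAlgebra p ⧸ 𝔭.asIdeal) →ₐ[ℤ_[p]] (IwasawaAlgebra p ⧸ 𝔭.asIdeal) :=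
    Ideal.quotientMapₐ 𝔭.asIdeal (invol p) (le_comap_invol_of_comap_invol_eq 𝔭 hι)
  have hσmk : ∀ f, σ (Ideal.Quotient.mk 𝔭.asIdeal f) = Ideal.Quotient.mk 𝔭.asIdeal (invol p f) := fun f ↦ rfl
  have hσσ : ∀ x, σ (σ x) = x := by
    intro x
    obtain ⟨f, rfl⟩ := Ideal.Quotient.mk_surjective x
    rw [hσmk, hσmk, invol_invol]
  -- the anti-invariant element `a = [T − ιT] ≠ 0`
  have ha : σ (Ideal.Quotient.mk 𝔭.asIdeal (PowerSeries.X - invol p PowerSeries.X)) =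
      -Ideal.Quotient.mk 𝔭.asIdeal (PowerSeries.X - invol p PowerSeries.X) := by
    rw [hσmk, map_sub (invol p), invol_invol, ← map_neg, neg_sub]
  have ha0 : Ideal.Quotient.mk 𝔭.asIdeal (PowerSeries.X - invol p PowerSeries.X) ≠ 0 := by
    rw [Ne, Ideal.Quotient.eq_zero_iff_mem]
    exact X_sub_invol_X_notMem hp2 𝔭.isPrime hX
  haveI : Module.Flat ℤ_[p] ℚ_[p] := flat_padic
  haveI := 𝔭.isPrime
  rw [lambdaInvariant_eq_finrank_tensorProduct]
  exact even_finrank_tensorProduct_of_involutive_of_ne_zero σ hσσ _ ha ha0 two_ne_zero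

/-! ### §3b The same for every `p` (incl. `p = 2`): exclude the second `ι`-fixed linear prime `(T + 2)` -/

/-- **`T − ιT ∉ 𝔭`** for every prime ideal `𝔭` of `Λ` containing neither `T` nor `T + 2` (ANY `p`): otherwise
`T(T+2) = (1+T)(T − ιT) ∈ 𝔭`. For `p ≠ 2` the second exclusion is automatic (`T + 2 ∈ Λˣ`, `X_sub_invol_X_notMem`);
for `p = 2` it excludes exactly the second `ι`-fixed height-one prime `(T + 2)` (the fixed points of
`u ↦ (1+u)⁻¹ − 1` on `𝔪_{ℤ₂}` are `0` and `−2`). [cite: MazurTateTeitelbaum1986Invent, Ch. I §17]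
[cite: Washington1997, §7.1 and §13.2] -/
theorem X_sub_invol_X_notMem_of_X_add_C_two_notMem {I : Ideal (IwasawaAlgebra p)} (hI : I.IsPrime)
    (hX : (PowerSeries.X : IwasawaAlgebra p) ∉ I)
    (hX2 : (PowerSeries.X + PowerSeries.C (2 : ℤ_[p]) : IwasawaAlgebra p) ∉ I) :
    PowerSeries.X - invol p PowerSeries.X ∉ I := by
  intro h
  have hmem : PowerSeries.X * (PowerSeries.X + PowerSeries.C (2 : ℤ_[p])) ∈ I := by
    rw [← one_add_X_mul_X_sub_invol_X p]
    exact I.mul_mem_left _ h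
  rcases hI.mem_or_mem hmem with h1 | h2
  · exact hX h1
  · exact hX2 h2

/-- **Even `λ` at `ι`-fixed primes, every `p` (the `p = 2` complement of
`even_lambdaInvariant_quotient_of_comap_invol_eq`).** Let `𝔭` be a prime of `Λ = ℤ_p⟦T⟧` fixed by the Iwasawa
involution (`ι𝔭 = 𝔭`) with `T ∉ 𝔭` AND `T + 2 ∉ 𝔭`. Then `λ(Λ/𝔭) = dim_{ℚ_p}(ℚ_p ⊗ Λ/𝔭)` is EVEN (same proof: `ι`
descends to the domain `Λ/𝔭`, the class of `T − ιT` is a non-zero anti-invariant element, §1). At `p = 2` both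
exclusions are necessary: `(T)` and `(T + 2)` are `ι`-fixed height-one primes with `λ = 1`
(`ι(T + 2) = (T + 2)(1 + T)⁻¹`). Use: for a torsion `Λ`-module with `ι`-stable characteristic ideal at `p = 2`
(Greenberg Thm. 1.14) the `λ`-mass outside the primes `(T)`, `(T+2)` is even.
[cite: MazurTateTeitelbaum1986Invent, Ch. I §17] [cite: GreenbergLNM1716, Thm. 1.14] -/
theorem even_lambdaInvariant_quotient_of_comap_invol_eq_of_X_add_C_two_notMem
    (𝔭 : PrimeSpectrum (IwasawaAlgebra p)) (hι : PrimeSpectrum.comap (invol p).toRingHom 𝔭 = 𝔭)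
    (hX : (PowerSeries.X : IwasawaAlgebra p) ∉ 𝔭.asIdeal)
    (hX2 : (PowerSeries.X + PowerSeries.C (2 : ℤ_[p]) : IwasawaAlgebra p) ∉ 𝔭.asIdeal) :
    Even (lambdaInvariant p (IwasawaAlgebra p ⧸ 𝔭.asIdeal)) := by
  let σ : (IwasawaAlgebra p ⧸ 𝔭.asIdeal) →ₐ[ℤ_[p]] (IwasawaAlgebra p ⧸ 𝔭.asIdeal) :=
    Ideal.quotientMapₐ 𝔭.asIdeal (invol p) (le_comap_invol_of_comap_invol_eq 𝔭 hι)
  have hσmk : ∀ f, σ (Ideal.Quotient.mk 𝔭.asIdeal f) = Ideal.Quotient.mk 𝔭.asIdeal (invol p f) := fun f ↦ rfl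
  have hσσ : ∀ x, σ (σ x) = x := by
    intro x
    obtain ⟨f, rfl⟩ := Ideal.Quotient.mk_surjective x
    rw [hσmk, hσmk, invol_invol]
  have ha : σ (Ideal.Quotient.mk 𝔭.asIdeal (PowerSeries.X - invol p PowerSeries.X)) =
      -Ideal.Quotient.mk 𝔭.asIdeal (PowerSeries.X - invol p PowerSeries.X) := by
    rw [hσmk, map_sub (invol p), invol_invol, ← map_neg, neg_sub]
  have ha0 : Ideal.Quotient.mk 𝔭.asIdeal (PowerSeries.X - invol p PowerSeries.X) ≠ 0 := by
    rw [Ne, Ideal.Quotient.eq_zero_iff_mem]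
    exact X_sub_invol_X_notMem_of_X_add_C_two_notMem 𝔭.isPrime hX hX2
  haveI : Module.Flat ℤ_[p] ℚ_[p] := flat_padic
  haveI := 𝔭.isPrime
  rw [lambdaInvariant_eq_finrank_tensorProduct]
  exact even_finrank_tensorProduct_of_involutive_of_ne_zero σ hσσ _ ha ha0 two_ne_zero

/-- Contrapositive, every `p`: a prime `𝔭` of `Λ` with `T ∉ 𝔭`, `T + 2 ∉ 𝔭` and ODD `λ(Λ/𝔭)` is moved by the
Iwasawa involution (`ι𝔭 ≠ 𝔭`). [cite: MazurTateTeitelbaum1986Invent, Ch. I §17] -/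
theorem comap_invol_ne_of_odd_lambdaInvariant_of_X_add_C_two_notMem (𝔭 : PrimeSpectrum (IwasawaAlgebra p))
    (hX : (PowerSeries.X : IwasawaAlgebra p) ∉ 𝔭.asIdeal)
    (hX2 : (PowerSeries.X + PowerSeries.C (2 : ℤ_[p]) : IwasawaAlgebra p) ∉ 𝔭.asIdeal)
    (hodd : Odd (lambdaInvariant p (IwasawaAlgebra p ⧸ 𝔭.asIdeal))) :
    PrimeSpectrum.comap (invol p).toRingHom 𝔭 ≠ 𝔭 := fun hι ↦
  (Nat.not_even_iff_odd.mpr hodd)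
    (even_lambdaInvariant_quotient_of_comap_invol_eq_of_X_add_C_two_notMem 𝔭 hι hX hX2)

/-! ## §4 Consequences: primes with odd `λ` are moved by `ι`; linear primes `(T − c)`, `c ≠ 0` -/

/-- Contrapositive of `even_lambdaInvariant_quotient_of_comap_invol_eq`: for `p ≠ 2`, a prime `𝔭 ∌ T` of `Λ` with ODD
`λ(Λ/𝔭)` is NOT fixed by the Iwasawa involution (`ι𝔭 ≠ 𝔭`): its `ι`-orbit has two points.
[cite: MazurTateTeitelbaum1986Invent, Ch. I §17] -/
theorem comap_invol_ne_of_odd_lambdaInvariant (hp2 : p ≠ 2) (𝔭 : PrimeSpectrum (IwasawaAlgebra p))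
    (hX : (PowerSeries.X : IwasawaAlgebra p) ∉ 𝔭.asIdeal)
    (hodd : Odd (lambdaInvariant p (IwasawaAlgebra p ⧸ 𝔭.asIdeal))) :
    PrimeSpectrum.comap (invol p).toRingHom 𝔭 ≠ 𝔭 := fun hι ↦
  (Nat.not_even_iff_odd.mpr hodd) (even_lambdaInvariant_quotient_of_comap_invol_eq hp2 𝔭 hι hX)

/-- `λ(Λ/(T − c)) = 1` for `c ∈ 𝔪_{ℤ_p}` (`Λ/(T − c) ≅ ℤ_p`, Weierstrass division; the tree's
`free_finrank_quotient_X_sub_C`). [cite: Washington1997, Prop. 13.8] -/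
theorem lambdaInvariant_quotient_span_X_sub_C {c : ℤ_[p]} (hc : c ∈ IsLocalRing.maximalIdeal ℤ_[p]) :
    lambdaInvariant p (IwasawaAlgebra p ⧸ Ideal.span {(PowerSeries.X - PowerSeries.C c : IwasawaAlgebra p)}) = 1 := by
  obtain ⟨hfree, _, h1⟩ := free_finrank_quotient_X_sub_C p hc
  haveI := hfree
  rw [lambdaInvariant_eq_finrank_tensorProduct, Module.finrank_baseChange, h1]

/-- `T ∉ (T − c)` for `c ∈ 𝔪_{ℤ_p}`, `c ≠ 0` (distinct linear primes are non-associated: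
`eq_of_X_sub_C_dvd_X_sub_C`). [cite: GreenbergLNM1716, §4 p. 117] -/
theorem X_notMem_span_X_sub_C {c : ℤ_[p]} (hc : c ∈ IsLocalRing.maximalIdeal ℤ_[p]) (hc0 : c ≠ 0) :
    (PowerSeries.X : IwasawaAlgebra p) ∉ Ideal.span {(PowerSeries.X - PowerSeries.C c : IwasawaAlgebra p)} := by
  intro h
  rw [Ideal.mem_span_singleton] at h
  have h' : (PowerSeries.X - PowerSeries.C c : IwasawaAlgebra p) ∣ PowerSeries.X - PowerSeries.C 0 := by
    rwa [map_zero, sub_zero]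
  exact hc0 (eq_of_X_sub_C_dvd_X_sub_C p hc h')

/-- **A linear prime `(T − c)`, `c ∈ 𝔪_{ℤ_p} ∖ {0}`, is never `ι`-fixed (`p` odd)**: for every point `𝔭` of `Spec Λ`
with `𝔭 = (T − c)`, `ι𝔭 ≠ 𝔭`. Equivalently the involution `u ↦ (1+u)⁻¹ − 1` of `𝔪_{ℤ_p}` has `0` as its only fixed
point; a `ℤ_p`-rational zero `u ≠ 0` of a power series and its mirror `ιu` are distinct.
[cite: MazurTateTeitelbaum1986Invent, Ch. I §17] -/
theorem comap_invol_ne_of_asIdeal_eq_span_X_sub_C (hp2 : p ≠ 2) {c : ℤ_[p]}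
    (hc : c ∈ IsLocalRing.maximalIdeal ℤ_[p]) (hc0 : c ≠ 0) (𝔭 : PrimeSpectrum (IwasawaAlgebra p))
    (h𝔭 : 𝔭.asIdeal = Ideal.span {(PowerSeries.X - PowerSeries.C c : IwasawaAlgebra p)}) :
    PrimeSpectrum.comap (invol p).toRingHom 𝔭 ≠ 𝔭 := by
  refine comap_invol_ne_of_odd_lambdaInvariant hp2 𝔭 (by rw [h𝔭]; exact X_notMem_span_X_sub_C hc hc0) ?_
  rw [h𝔭, lambdaInvariant_quotient_span_X_sub_C hc]
  exact odd_one

/-! ### §4b Where `ι` moves a linear prime: `ι(T − c') ∈ (T − c)·Λˣ` for `(1 + c)(1 + c') = 1` -/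

/-- **The mirror of a linear prime, explicitly**: if `(1 + c)(1 + c') = 1` in `ℤ_p` then
`ι(T − c') = (T − c) · (−(1+T)⁻¹(1 + c'))` in `Λ` — so `ι` carries the zero `c'` to the zero `c = (1+c')⁻¹ − 1`
(`γ ↦ γ⁻¹` on `1 + 𝔪_{ℤ_p}`). [cite: MazurTateTeitelbaum1986Invent, Ch. I §17] -/
theorem invol_X_sub_C_eq_mul {c c' : ℤ_[p]} (h : (1 + c) * (1 + c') = 1) :
    invol p (PowerSeries.X - PowerSeries.C c') =
      (PowerSeries.X - PowerSeries.C c) * (-(1 + invSubOne p) * (1 + PowerSeries.C c')) := by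
  rw [map_sub, invol_X, invol_C]
  have h1 := one_add_X_mul_one_add_invSubOne p
  have h2 : (1 + PowerSeries.C c : IwasawaAlgebra p) * (1 + PowerSeries.C c') = 1 := by
    rw [← map_one PowerSeries.C, ← map_add, ← map_add, ← map_mul, h]
  linear_combination (1 + PowerSeries.C c') * h1 - (1 + invSubOne p) * h2

/-- **`ι⁻¹(T − c) = (T − c')` as ideals of `Λ`** whenever `(1 + c)(1 + c') = 1` in `ℤ_p`: the Iwasawa involution
permutes the linear primes `(T − c)`, `c ∈ 𝔪_{ℤ_p}`, through `1 + c ↦ (1 + c)⁻¹`. [cite: MazurTateTeitelbaum1986Invent, Ch. I §17] -/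
theorem comap_invol_span_X_sub_C {c c' : ℤ_[p]} (h : (1 + c) * (1 + c') = 1) :
    (Ideal.span {(PowerSeries.X - PowerSeries.C c : IwasawaAlgebra p)}).comap (invol p).toRingHom =
      Ideal.span {(PowerSeries.X - PowerSeries.C c' : IwasawaAlgebra p)} := by
  have h' : (1 + c') * (1 + c) = 1 := by rw [mul_comm]; exact h
  apply le_antisymm
  · intro f hf
    rw [Ideal.mem_comap, Ideal.mem_span_singleton] at hf
    change (PowerSeries.X - PowerSeries.C c : IwasawaAlgebra p) ∣ invol p f at hf
    rw [Ideal.mem_span_singleton]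
    have hf' := map_dvd (invol p) hf
    rw [invol_invol, invol_X_sub_C_eq_mul h'] at hf'
    exact dvd_trans (Dvd.intro _ rfl) hf'
  · rw [Ideal.span_singleton_le_iff_mem, Ideal.mem_comap]
    change invol p (PowerSeries.X - PowerSeries.C c') ∈ _
    rw [Ideal.mem_span_singleton, invol_X_sub_C_eq_mul h]
    exact Dvd.intro _ rfl

/-- The same on points of `Spec Λ`: if `𝔭 = (T − c)` and `(1 + c)(1 + c') = 1` then `(ι𝔭) = (T − c')`.
[cite: MazurTateTeitelbaum1986Invent, Ch. I §17] -/
theorem comap_invol_asIdeal_eq_span_X_sub_C {c c' : ℤ_[p]} (h : (1 + c) * (1 + c') = 1)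
    (𝔭 : PrimeSpectrum (IwasawaAlgebra p))
    (h𝔭 : 𝔭.asIdeal = Ideal.span {(PowerSeries.X - PowerSeries.C c : IwasawaAlgebra p)}) :
    (PrimeSpectrum.comap (invol p).toRingHom 𝔭).asIdeal =
      Ideal.span {(PowerSeries.X - PowerSeries.C c' : IwasawaAlgebra p)} := by
  rw [PrimeSpectrum.comap_asIdeal, h𝔭]
  exact comap_invol_span_X_sub_C h

/-! ### §4c `λ` is constant on `ι`-orbits: `λ(Λ/ι⁻¹𝔭) = λ(Λ/𝔭)` -/

/-- **`λ(Λ/ι⁻¹𝔭) = λ(Λ/𝔭)`** for every ideal `𝔭` of `Λ`: `ι` induces an `ι`-semilinear additive isomorphism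
`Λ/ι⁻¹𝔭 ≃ Λ/𝔭`, and `λ` is invariant under `ι`-semilinear isomorphisms (`lambdaInvariant_eq_of_involSemilinear`;
`ι` fixes constants). So the degree `d(𝔭) = λ(Λ/𝔭)` is an `ι`-SYMMETRIC weight on `Spec Λ`.
[cite: GreenbergLNM1716, §1 (p. 60)] -/
theorem lambdaInvariant_quotient_comap_invol_eq (I : Ideal (IwasawaAlgebra p)) :
    lambdaInvariant p (IwasawaAlgebra p ⧸ I.comap (invol p).toRingHom) =
      lambdaInvariant p (IwasawaAlgebra p ⧸ I) := by
  -- the ring isomorphism `Λ/ι⁻¹I ≃ Λ/I` induced by `ι` (`ι(ι⁻¹ I) = I` as `ι` is surjective)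
  have hmap : I = Ideal.map (involEquiv p : IwasawaAlgebra p ≃+* IwasawaAlgebra p)
      (I.comap (invol p).toRingHom) := by
    change I = Ideal.map (invol p).toRingHom (I.comap (invol p).toRingHom)
    exact (Ideal.map_comap_of_surjective (invol p).toRingHom (invol_bijective p).2 I).symm
  let e : (IwasawaAlgebra p ⧸ I.comap (invol p).toRingHom) ≃+* (IwasawaAlgebra p ⧸ I) :=
    Ideal.quotientEquiv (I.comap (invol p).toRingHom) I (involEquiv p : IwasawaAlgebra p ≃+* IwasawaAlgebra p) hmap
  have he : ∀ f, e (Ideal.Quotient.mk _ f) = Ideal.Quotient.mk I (invol p f) := fun f ↦ rfl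
  have key := lambdaInvariant_eq_of_involSemilinear (p := p) e.toAddEquiv fun f x ↦ by
    obtain ⟨g, rfl⟩ := Ideal.Quotient.mk_surjective x
    change e (Ideal.Quotient.mk _ (f * g)) = invol p f • e (Ideal.Quotient.mk _ g)
    rw [he, he, map_mul]
    rfl
  exact key.symm

/-- The same on points of `Spec Λ`: `λ(Λ/(ι𝔭)) = λ(Λ/𝔭)`. [cite: GreenbergLNM1716, §1 (p. 60)] -/
theorem lambdaInvariant_quotient_comap_invol_asIdeal_eq (𝔭 : PrimeSpectrum (IwasawaAlgebra p)) :
    lambdaInvariant p (IwasawaAlgebra p ⧸ (PrimeSpectrum.comap (invol p).toRingHom 𝔭).asIdeal) =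
      lambdaInvariant p (IwasawaAlgebra p ⧸ 𝔭.asIdeal) := by
  rw [PrimeSpectrum.comap_asIdeal]
  exact lambdaInvariant_quotient_comap_invol_eq 𝔭.asIdeal

end Literature.NumberTheory.EllipticCurves.IwasawaAlgebra

end
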